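import Literature.Analysis.SegalBargmann.SchwartzHeisenbergSchur
import Literature.Analysis.SegalBargmann.SchwartzTensorPi
import HarnessLib

/-!
# Two-factor Schur lemma for the Schrödinger representation on `𝓢(ℝ^{σ₁} × ℝ^{σ₂})` (Folland 1989, §1.3–§1.7)

Topic `Analysis/SegalBargmann`; namespace `Literature.Analysis.SegalBargmann`.  On the Folland carriers
`𝓢(σ → ℝ, ℂ)`, with the product in separate variables `tensorPi f g = f ⊠ g` on `σ₁ ⊕ σ₂ → ℝ` (`SchwartzTensorPi`)
and Folland's Heisenberg operators `rhoS p q` (`SchrodingerSchwartzBridge`):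

* §1 the Heisenberg operators FACTOR on pure tensors:
  `rhoS (Sum.elim p₁ p₂) (Sum.elim q₁ q₂) (f ⊠ g) = rhoS p₁ q₁ f ⊠ rhoS p₂ q₂ g` (`rhoS_tensorPi`), and the
  block-diagonal phase-space maps `blockPhase s₁ s₂` of `(σ₁ ⊕ σ₂ → ℝ)²`;
* §2 Hermite coefficients on the Folland carrier (`piCoeff α f = c_α(f ∘ ·)`, an integral against `hermitePi α`),
  the expansion `f = Σ_β c_β(f) h_β` and the COEFFICIENT ACTION of a continuous operator
  `c_α(A f) = Σ_β c_α(A h_β) c_β(f)` (`hasSum_piCoeff_apply`), and the FACTORISATION on pure tensors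
  `c_{(β₁,β₂)}(f ⊠ g) = c_{β₁}(f) c_{β₂}(g)` (`piCoeff_sumIdx_tensorPi`, Fubini along
  `MeasurableEquiv.sumPiEquivProdPi`); a continuous linear map out of `𝓢(σ₁ ⊕ σ₂ → ℝ)` is determined by its
  values on the `h_{β₁} ⊠ h_{β₂}` (`clm_eq_of_eq_on_tensorPi_hermitePi`);
* §3 **the two-factor Schur lemma**: if `M : 𝓢(σ₁ ⊕ σ₂ → ℝ) ≃L 𝓢(σ₁ ⊕ σ₂ → ℝ)` is covariant over the
  block-diagonal map `blockPhase s₁ s₂` (`M ρ(v) = ρ(S v) M`, phase-free as in `implements_ofSymplectic_iff`),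
  `A_j : 𝓢(σ_j → ℝ) →L 𝓢(σ_j → ℝ)` are covariant over `s_j`, and `T` is ANY continuous operator with
  `T (f ⊠ g) = A₁ f ⊠ A₂ g`, then `T = c • M` (`exists_smul_of_tensor_covariant`), so
  `A₁ f ⊠ A₂ g = c • M (f ⊠ g)`; `c ≠ 0` as soon as `A₁, A₂ ≠ 0` (`exists_ne_zero_smul_of_tensor_covariant`).
  Proof: `T` inherits the covariance of `M` (checked on the `h_{β₁} ⊠ h_{β₂}` by §1), so `M⁻¹ T` commutes with
  every `ρ(p,q)` and is a scalar by `eq_smul_of_commute_rhoS` (`SchwartzHeisenbergSchur`).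

The existence of such a continuous extension `T = A₁ ⊠̂ A₂` (Hermite matrix route) is the business of the companion
files `HermiteMatrixOperators` / `SchwartzTensorOperators`; this file is independent of it.  Everything is proved from
Mathlib and the imported tree files; no cited statement is used as a hypothesis.

## References

* [Folland1989] G. B. Folland, *Harmonic Analysis in Phase Space*, Princeton UP (1989), §1.3 (1.25) (the operators
  `ρ(p,q)`), §1.4 Prop. (1.43) (irreducibility / Schur), §1.7 (Hermite functions on `ℝⁿ` are products).
  [cite: Folland1989, §1.7]
* [MoeglinVignerasWaldspurger1987] C. Moeglin, M.-F. Vignéras, J.-L. Waldspurger, *Correspondances de Howe sur un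
  corps p-adique*, LNM 1291 (1987), Chap. 2, II.1–II.2 ("M est unique à un scalaire près").

## Provenance

LEAN-IN-TREE rule (2026-08-18), pub-hodgecm model-construction sub-cell, seat mc-binder-2 gen 3 (node W2-⊗, piece
(⊗S)-∞: two-factor continuous Schur, abstract form + coefficient factorisation).
-/

set_option autoImplicit false

noncomputable section

open MeasureTheory Complex SchwartzMap Filter Topology
open scoped BigOperators Real

namespace Literature.Analysis.SegalBargmann

local notation "SR" σ:max => (SchwartzMap (σ → ℝ) ℂ)
local notation "SE" σ:max => (SchwartzMap (EuclideanSpace ℝ σ) ℂ)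

/-! ## §1  Heisenberg operators on pure tensors and block-diagonal phase-space maps -/

section Rho

variable {σ₁ σ₂ : Type*} [Fintype σ₁] [Fintype σ₂]

/-- Folland's multiplier factors across the two groups of variables:
`rhoMul (p₁,p₂) (q₁,q₂) x = rhoMul p₁ q₁ (x ∘ inl) · rhoMul p₂ q₂ (x ∘ inr)`. [folklore] -/
theorem rhoMul_sum_elim (p₁ q₁ : σ₁ → ℝ) (p₂ q₂ : σ₂ → ℝ) (x : σ₁ ⊕ σ₂ → ℝ) :
    rhoMul (Sum.elim p₁ p₂) (Sum.elim q₁ q₂) x =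
      rhoMul p₁ q₁ (x ∘ Sum.inl) * rhoMul p₂ q₂ (x ∘ Sum.inr) := by
  rw [rhoMul, rhoMul, rhoMul, ← Complex.exp_add]
  congr 1
  simp only [Fintype.sum_sum_type, Sum.elim_inl, Sum.elim_inr, Function.comp_apply]
  push_cast
  ring

/-- **The Heisenberg operators factor on pure tensors**:
`ρ((p₁,p₂),(q₁,q₂)) (f ⊠ g) = ρ(p₁,q₁) f ⊠ ρ(p₂,q₂) g`. [cite: Folland1989, (1.25)] -/
theorem rhoS_tensorPi (p₁ q₁ : σ₁ → ℝ) (p₂ q₂ : σ₂ → ℝ) (f : SR σ₁) (g : SR σ₂) :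
    rhoS (Sum.elim p₁ p₂) (Sum.elim q₁ q₂) (tensorPi f g) = tensorPi (rhoS p₁ q₁ f) (rhoS p₂ q₂ g) := by
  ext x
  have h1 : (x + Sum.elim p₁ p₂) ∘ Sum.inl = x ∘ Sum.inl + p₁ := by
    funext i; simp only [Function.comp_apply, Pi.add_apply, Sum.elim_inl]
  have h2 : (x + Sum.elim p₁ p₂) ∘ Sum.inr = x ∘ Sum.inr + p₂ := by
    funext i; simp only [Function.comp_apply, Pi.add_apply, Sum.elim_inr]
  rw [rhoS_apply, tensorPi_apply, tensorPi_apply, rhoS_apply, rhoS_apply, rhoMul_sum_elim, h1, h2]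
  ring

omit [Fintype σ₁] [Fintype σ₂] in
/-- A phase-space vector on `σ₁ ⊕ σ₂` is the `Sum.elim` of its restrictions. [folklore] -/
theorem sum_elim_comp_inl_inr (P : σ₁ ⊕ σ₂ → ℝ) : Sum.elim (P ∘ Sum.inl) (P ∘ Sum.inr) = P :=
  Sum.elim_comp_inl_inr P

/-- **The block-diagonal phase-space map** of two self-maps `s_j` of `(σ_j → ℝ)²`: it acts on
`((σ₁ ⊕ σ₂) → ℝ)²` by `s₁` on the `σ₁`-coordinates and by `s₂` on the `σ₂`-coordinates. [folklore] -/
def blockPhase (s₁ : (σ₁ → ℝ) × (σ₁ → ℝ) → (σ₁ → ℝ) × (σ₁ → ℝ))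
    (s₂ : (σ₂ → ℝ) × (σ₂ → ℝ) → (σ₂ → ℝ) × (σ₂ → ℝ)) :
    (σ₁ ⊕ σ₂ → ℝ) × (σ₁ ⊕ σ₂ → ℝ) → (σ₁ ⊕ σ₂ → ℝ) × (σ₁ ⊕ σ₂ → ℝ) := fun PQ =>
  (Sum.elim (s₁ (PQ.1 ∘ Sum.inl, PQ.2 ∘ Sum.inl)).1 (s₂ (PQ.1 ∘ Sum.inr, PQ.2 ∘ Sum.inr)).1,
    Sum.elim (s₁ (PQ.1 ∘ Sum.inl, PQ.2 ∘ Sum.inl)).2 (s₂ (PQ.1 ∘ Sum.inr, PQ.2 ∘ Sum.inr)).2)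

omit [Fintype σ₁] [Fintype σ₂] in
/-- The block-diagonal map on `Sum.elim` vectors. [folklore] -/
@[simp] theorem blockPhase_elim (s₁ : (σ₁ → ℝ) × (σ₁ → ℝ) → (σ₁ → ℝ) × (σ₁ → ℝ))
    (s₂ : (σ₂ → ℝ) × (σ₂ → ℝ) → (σ₂ → ℝ) × (σ₂ → ℝ)) (p₁ q₁ : σ₁ → ℝ) (p₂ q₂ : σ₂ → ℝ) :
    blockPhase s₁ s₂ (Sum.elim p₁ p₂, Sum.elim q₁ q₂) =
      (Sum.elim (s₁ (p₁, q₁)).1 (s₂ (p₂, q₂)).1, Sum.elim (s₁ (p₁, q₁)).2 (s₂ (p₂, q₂)).2) := by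
  simp only [blockPhase, Sum.elim_comp_inl, Sum.elim_comp_inr]

omit [Fintype σ₁] [Fintype σ₂] in
/-- The block-diagonal map of two surjections is surjective. [folklore] -/
theorem blockPhase_surjective {s₁ : (σ₁ → ℝ) × (σ₁ → ℝ) → (σ₁ → ℝ) × (σ₁ → ℝ)}
    {s₂ : (σ₂ → ℝ) × (σ₂ → ℝ) → (σ₂ → ℝ) × (σ₂ → ℝ)} (h₁ : Function.Surjective s₁)
    (h₂ : Function.Surjective s₂) : Function.Surjective (blockPhase s₁ s₂) := by
  rintro ⟨P, Q⟩
  obtain ⟨⟨p₁, q₁⟩, e₁⟩ := h₁ (P ∘ Sum.inl, Q ∘ Sum.inl)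
  obtain ⟨⟨p₂, q₂⟩, e₂⟩ := h₂ (P ∘ Sum.inr, Q ∘ Sum.inr)
  refine ⟨(Sum.elim p₁ p₂, Sum.elim q₁ q₂), ?_⟩
  rw [blockPhase_elim, e₁, e₂]
  simp only [sum_elim_comp_inl_inr]

end Rho

/-! ## §2  Hermite coefficients on the Folland carrier; factorisation on pure tensors -/

section Coeff

variable {σ : Type*} [Fintype σ] [DecidableEq σ]

/-- **The Hermite coefficient on the Folland carrier**: `piCoeff α f := c_α(f ∘ euclE)`, the coefficient of the
function transported to `EuclideanSpace ℝ σ`. [cite: Folland1989, §1.7] -/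
def piCoeff (α : σ →₀ ℕ) (f : SR σ) : ℂ := hermiteCoeff α ((schwartzTransport (euclE σ)).symm f)

/-- Unfolding. [folklore] -/
theorem piCoeff_def (α : σ →₀ ℕ) (f : SR σ) :
    piCoeff α f = hermiteCoeff α ((schwartzTransport (euclE σ)).symm f) := rfl

/-- `piCoeff α (e g) = c_α(g)` for the transport `e = schwartzTransport euclE`. [folklore] -/
@[simp] theorem piCoeff_schwartzTransport (α : σ →₀ ℕ) (g : SE σ) :
    piCoeff α (schwartzTransport (euclE σ) g) = hermiteCoeff α g := by
  rw [piCoeff, ContinuousLinearEquiv.symm_apply_apply]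

/-- **The coefficient as an integral on `σ → ℝ`**: `piCoeff α f = ∫ h_α(x) f(x) dx`. [cite: Folland1989, §1.7] -/
theorem piCoeff_eq_integral (α : σ →₀ ℕ) (f : SR σ) :
    piCoeff α f = ∫ x : σ → ℝ, hermitePi α x * f x := by
  rw [piCoeff, hermiteCoeff_apply]
  have h := (measurePreserving_euclE (σ := σ)).integral_comp
    (euclE σ).toHomeomorph.measurableEmbedding (fun y : σ → ℝ => hermitePi α y * f y)
  simpa only [hermitePi_apply, hermiteSchwartz_apply, schwartzTransport_symm_apply, euclE_apply] using h

/-- `piCoeff` is additive. [folklore] -/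
theorem piCoeff_add (α : σ →₀ ℕ) (f g : SR σ) : piCoeff α (f + g) = piCoeff α f + piCoeff α g := by
  rw [piCoeff, map_add, hermiteCoeff_add, piCoeff, piCoeff]

/-- `piCoeff` is homogeneous. [folklore] -/
theorem piCoeff_smul (α : σ →₀ ℕ) (c : ℂ) (f : SR σ) : piCoeff α (c • f) = c * piCoeff α f := by
  rw [piCoeff, map_smul, hermiteCoeff_smul, piCoeff]

/-- **The coefficient functional** `piCoeff α` as a continuous linear form on `𝓢(ℝ^σ, ℂ)`. [folklore] -/
def piCoeffCLM (α : σ →₀ ℕ) : (SR σ) →L[ℂ] ℂ :=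
  (hermiteCoeffCLM α).comp ((schwartzTransport (euclE σ)).symm : (SR σ) →L[ℂ] SE σ)

/-- Unfolding. [folklore] -/
@[simp] theorem piCoeffCLM_apply (α : σ →₀ ℕ) (f : SR σ) : piCoeffCLM α f = piCoeff α f := by
  rw [piCoeffCLM, ContinuousLinearMap.comp_apply, hermiteCoeffCLM_apply]; rfl

/-- The coefficients of the Hermite functions: `c_α(h_β) = δ_{αβ}`. [cite: Folland1989, §1.7] -/
theorem piCoeff_hermitePi (α β : σ →₀ ℕ) : piCoeff α (hermitePi β : SR σ) = if α = β then 1 else 0 := by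
  rw [piCoeff, schwartzTransport_symm_hermitePi, hermiteCoeff_herm]

/-- **The Hermite expansion on the Folland carrier**: `f = Σ_β c_β(f) h_β` IN `𝓢(ℝ^σ, ℂ)`. [cite: Folland1989, §1.7] -/
theorem hasSum_piCoeff_smul_hermitePi (f : SR σ) :
    HasSum (fun β : σ →₀ ℕ => piCoeff β f • (hermitePi β : SR σ)) f :=
  hasSum_hermiteCoeff_smul_hermitePi f

/-- Two Schwartz functions on `σ → ℝ` with the same Hermite coefficients are equal. [cite: Folland1989, §1.7] -/
theorem ext_piCoeff {f g : SR σ} (h : ∀ α : σ →₀ ℕ, piCoeff α f = piCoeff α g) : f = g :=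
  (schwartzTransport (euclE σ)).symm.injective (ext_hermiteCoeff h)

/-- The coefficients are rapidly decreasing: `Σ_α (|α|+1)^μ ‖c_α(f)‖ < ∞`. [cite: Folland1989, §1.7] -/
theorem summable_degree_pow_mul_norm_piCoeff (μ : ℕ) (f : SR σ) :
    Summable fun α : σ →₀ ℕ => ((α.degree : ℝ) + 1) ^ μ * ‖piCoeff α f‖ :=
  summable_degree_pow_mul_norm_hermiteCoeff μ _

/-- In particular `Σ_α ‖c_α(f)‖ < ∞`. [cite: Folland1989, §1.7] -/
theorem summable_norm_piCoeff (f : SR σ) : Summable fun α : σ →₀ ℕ => ‖piCoeff α f‖ :=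
  summable_norm_hermiteCoeff _

/-- **The coefficient action of a continuous operator** (its Hermite matrix acts on the coefficient sequence):
`c_α(A f) = Σ_β c_α(A h_β) · c_β(f)`. [cite: Folland1989, §1.7] -/
theorem hasSum_piCoeff_apply {Y : Type*} [AddCommMonoid Y] [Module ℂ Y] [TopologicalSpace Y]
    (A : (SR σ) →L[ℂ] Y) (f : SR σ) :
    HasSum (fun β : σ →₀ ℕ => piCoeff β f • A (hermitePi β)) (A f) := by
  simpa only [ContinuousLinearMap.map_smul] using (hasSum_piCoeff_smul_hermitePi f).mapL A

/-- Scalar form: for a continuous `A : 𝓢 → 𝓢`, `c_α(A f) = Σ' β, c_α(A h_β) c_β(f)`. [cite: Folland1989, §1.7] -/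
theorem hasSum_piCoeff_apply_coeff (A : (SR σ) →L[ℂ] SR σ) (α : σ →₀ ℕ) (f : SR σ) :
    HasSum (fun β : σ →₀ ℕ => piCoeff α (A (hermitePi β)) * piCoeff β f) (piCoeff α (A f)) := by
  have h := (hasSum_piCoeff_apply A f).mapL (piCoeffCLM α)
  simp only [piCoeffCLM_apply, piCoeff_smul] at h
  simpa only [mul_comm] using h

/-- `tsum` form of `hasSum_piCoeff_apply_coeff`. [cite: Folland1989, §1.7] -/
theorem piCoeff_apply_eq_tsum (A : (SR σ) →L[ℂ] SR σ) (α : σ →₀ ℕ) (f : SR σ) :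
    piCoeff α (A f) = ∑' β : σ →₀ ℕ, piCoeff α (A (hermitePi β)) * piCoeff β f :=
  (hasSum_piCoeff_apply_coeff A α f).tsum_eq.symm

end Coeff

section Factor

variable {σ₁ σ₂ : Type*} [Fintype σ₁] [Fintype σ₂]

/-- A nonzero pure tensor: `f ⊠ g ≠ 0` if `f ≠ 0` and `g ≠ 0`. [folklore] -/
theorem tensorPi_ne_zero {f : SR σ₁} {g : SR σ₂} (hf : f ≠ 0) (hg : g ≠ 0) : tensorPi f g ≠ 0 := by
  obtain ⟨x, hx⟩ : ∃ x, f x ≠ 0 := by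
    by_contra h; push Not at h; exact hf (SchwartzMap.ext h)
  obtain ⟨y, hy⟩ : ∃ y, g y ≠ 0 := by
    by_contra h; push Not at h; exact hg (SchwartzMap.ext h)
  intro h
  have h1 := congrArg (fun F : SR (σ₁ ⊕ σ₂) => F (Sum.elim x y)) h
  simp only [tensorPi_apply, Sum.elim_comp_inl, Sum.elim_comp_inr, zero_apply, mul_eq_zero] at h1
  exact h1.elim hx hy

/-- **Product integrals split along `σ₁ ⊕ σ₂`**: `∫ F(x ∘ inl) G(x ∘ inr) dx = (∫ F)(∫ G)` (Fubini through
`MeasurableEquiv.sumPiEquivProdPi`). [folklore] -/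
theorem integral_mul_comp_inl_inr (F : (σ₁ → ℝ) → ℂ) (G : (σ₂ → ℝ) → ℂ) :
    ∫ x : σ₁ ⊕ σ₂ → ℝ, F (x ∘ Sum.inl) * G (x ∘ Sum.inr) =
      (∫ y : σ₁ → ℝ, F y) * ∫ z : σ₂ → ℝ, G z := by
  have hmp := volume_measurePreserving_sumPiEquivProdPi (fun _ : σ₁ ⊕ σ₂ => ℝ)
  have h := hmp.integral_comp' (g := fun w : (σ₁ → ℝ) × (σ₂ → ℝ) => F w.1 * G w.2)
  rw [MeasureTheory.Measure.volume_eq_prod, integral_prod_mul] at h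
  simpa only [MeasurableEquiv.coe_sumPiEquivProdPi, Equiv.sumPiEquivProdPi_apply, Function.comp_def] using h

variable [DecidableEq σ₁] [DecidableEq σ₂]

/-- **The Hermite coefficients of a pure tensor factor**: `c_{(β₁,β₂)}(f ⊠ g) = c_{β₁}(f) · c_{β₂}(g)`.
[cite: Folland1989, §1.7] -/
theorem piCoeff_sumIdx_tensorPi (β₁ : σ₁ →₀ ℕ) (β₂ : σ₂ →₀ ℕ) (f : SR σ₁) (g : SR σ₂) :
    piCoeff (sumIdx β₁ β₂) (tensorPi f g) = piCoeff β₁ f * piCoeff β₂ g := by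
  rw [piCoeff_eq_integral, piCoeff_eq_integral, piCoeff_eq_integral, hermitePi_sumIdx,
    ← integral_mul_comp_inl_inr]
  refine integral_congr_ae (Eventually.of_forall fun x => ?_)
  simp only [tensorPi_apply]
  ring

/-- Coefficient form with the two restrictions of a multi-index on `σ₁ ⊕ σ₂`. [cite: Folland1989, §1.7] -/
theorem piCoeff_tensorPi (β : σ₁ ⊕ σ₂ →₀ ℕ) (f : SR σ₁) (g : SR σ₂) :
    piCoeff β (tensorPi f g) =
      piCoeff (β.comapDomain Sum.inl Sum.inl_injective.injOn) f *
        piCoeff (β.comapDomain Sum.inr Sum.inr_injective.injOn) g := by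
  rw [← piCoeff_sumIdx_tensorPi, sumIdx_comapDomain]

variable {Y : Type*} [AddCommMonoid Y] [Module ℂ Y] [TopologicalSpace Y] [T2Space Y]

/-- **Continuous linear maps out of `𝓢(ℝ^{σ₁ ⊕ σ₂})` are determined on the pure tensors of Hermite functions**
`h_{β₁} ⊠ h_{β₂}`. [cite: Folland1989, §1.7] -/
theorem clm_eq_of_eq_on_tensorPi_hermitePi {S T : (SR (σ₁ ⊕ σ₂)) →L[ℂ] Y}
    (h : ∀ (β₁ : σ₁ →₀ ℕ) (β₂ : σ₂ →₀ ℕ),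
      S (tensorPi (hermitePi β₁) (hermitePi β₂)) = T (tensorPi (hermitePi β₁) (hermitePi β₂))) : S = T :=
  clm_eq_of_eq_on_hermitePi fun β => by rw [hermitePi_eq_tensorPi]; exact h _ _

/-- In particular they are determined on all pure tensors `f ⊠ g`. [folklore] -/
theorem clm_eq_of_eq_on_tensorPi {S T : (SR (σ₁ ⊕ σ₂)) →L[ℂ] Y}
    (h : ∀ (f : SR σ₁) (g : SR σ₂), S (tensorPi f g) = T (tensorPi f g)) : S = T :=
  clm_eq_of_eq_on_tensorPi_hermitePi fun _ _ => h _ _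

end Factor

/-! ## §3  The two-factor Schur lemma -/

section Schur

variable {σ₁ σ₂ : Type*} [Fintype σ₁] [Fintype σ₂] [DecidableEq σ₁] [DecidableEq σ₂]

variable {s₁ : (σ₁ → ℝ) × (σ₁ → ℝ) → (σ₁ → ℝ) × (σ₁ → ℝ)}
  {s₂ : (σ₂ → ℝ) × (σ₂ → ℝ) → (σ₂ → ℝ) × (σ₂ → ℝ)}

/-- **A tensor extension inherits the block covariance.** If `A_j ρ(v) = ρ(s_j v) A_j` on `𝓢(ℝ^{σ_j})` and the
continuous `T` on `𝓢(ℝ^{σ₁ ⊕ σ₂})` satisfies `T (f ⊠ g) = A₁ f ⊠ A₂ g`, then `T ρ(v) = ρ(blockPhase s₁ s₂ v) T`.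
[folklore] -/
theorem tensor_covariant (A₁ : (SR σ₁) →L[ℂ] SR σ₁) (A₂ : (SR σ₂) →L[ℂ] SR σ₂)
    (hA₁ : ∀ (p q : σ₁ → ℝ) (f : SR σ₁), A₁ (rhoS p q f) = rhoS (s₁ (p, q)).1 (s₁ (p, q)).2 (A₁ f))
    (hA₂ : ∀ (p q : σ₂ → ℝ) (g : SR σ₂), A₂ (rhoS p q g) = rhoS (s₂ (p, q)).1 (s₂ (p, q)).2 (A₂ g))
    (T : (SR (σ₁ ⊕ σ₂)) →L[ℂ] SR (σ₁ ⊕ σ₂))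
    (hT : ∀ (f : SR σ₁) (g : SR σ₂), T (tensorPi f g) = tensorPi (A₁ f) (A₂ g))
    (P Q : σ₁ ⊕ σ₂ → ℝ) (F : SR (σ₁ ⊕ σ₂)) :
    T (rhoS P Q F) = rhoS (blockPhase s₁ s₂ (P, Q)).1 (blockPhase s₁ s₂ (P, Q)).2 (T F) := by
  have key : T.comp (rhoS P Q) =
      (rhoS (blockPhase s₁ s₂ (P, Q)).1 (blockPhase s₁ s₂ (P, Q)).2).comp T := by
    refine clm_eq_of_eq_on_tensorPi fun f g => ?_
    rw [ContinuousLinearMap.comp_apply, ContinuousLinearMap.comp_apply, hT,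
      ← sum_elim_comp_inl_inr P, ← sum_elim_comp_inl_inr Q, rhoS_tensorPi, hT, hA₁, hA₂, blockPhase_elim,
      rhoS_tensorPi]
  exact congrArg (fun R : (SR (σ₁ ⊕ σ₂)) →L[ℂ] SR (σ₁ ⊕ σ₂) => R F) key

/-- **Two-factor Schur lemma (operator form).** Let `M` be a continuous linear automorphism of
`𝓢(ℝ^{σ₁ ⊕ σ₂})` covariant over the block-diagonal phase-space map `blockPhase s₁ s₂`
(`M ρ(v) = ρ(S v) M`, the phase-free shape of `implements_ofSymplectic_iff`), let `A_j` be continuous operators of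
`𝓢(ℝ^{σ_j})` covariant over `s_j`, and let `T` be any continuous operator with `T (f ⊠ g) = A₁ f ⊠ A₂ g`.  Then
`T = c • M` for the scalar `c = schurCoeff (M⁻¹ T)`. [cite: Folland1989, Prop. (1.43)] -/
theorem eq_smul_of_tensor_covariant (M : (SR (σ₁ ⊕ σ₂)) ≃L[ℂ] SR (σ₁ ⊕ σ₂))
    (hM : ∀ (P Q : σ₁ ⊕ σ₂ → ℝ) (F : SR (σ₁ ⊕ σ₂)),
      M (rhoS P Q F) = rhoS (blockPhase s₁ s₂ (P, Q)).1 (blockPhase s₁ s₂ (P, Q)).2 (M F))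
    (A₁ : (SR σ₁) →L[ℂ] SR σ₁) (A₂ : (SR σ₂) →L[ℂ] SR σ₂)
    (hA₁ : ∀ (p q : σ₁ → ℝ) (f : SR σ₁), A₁ (rhoS p q f) = rhoS (s₁ (p, q)).1 (s₁ (p, q)).2 (A₁ f))
    (hA₂ : ∀ (p q : σ₂ → ℝ) (g : SR σ₂), A₂ (rhoS p q g) = rhoS (s₂ (p, q)).1 (s₂ (p, q)).2 (A₂ g))
    (T : (SR (σ₁ ⊕ σ₂)) →L[ℂ] SR (σ₁ ⊕ σ₂))
    (hT : ∀ (f : SR σ₁) (g : SR σ₂), T (tensorPi f g) = tensorPi (A₁ f) (A₂ g)) (F : SR (σ₁ ⊕ σ₂)) :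
    T F = schurCoeff (((M.symm : (SR (σ₁ ⊕ σ₂)) ≃L[ℂ] SR (σ₁ ⊕ σ₂)) :
      (SR (σ₁ ⊕ σ₂)) →L[ℂ] SR (σ₁ ⊕ σ₂)).comp T) • M F := by
  set R : (SR (σ₁ ⊕ σ₂)) →L[ℂ] SR (σ₁ ⊕ σ₂) :=
    ((M.symm : (SR (σ₁ ⊕ σ₂)) ≃L[ℂ] SR (σ₁ ⊕ σ₂)) : (SR (σ₁ ⊕ σ₂)) →L[ℂ] SR (σ₁ ⊕ σ₂)).comp T with hRdef
  have hRapp : ∀ G, R G = M.symm (T G) := fun G => rfl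
  -- `M⁻¹` is covariant the other way round
  have hMs : ∀ (P Q : σ₁ ⊕ σ₂ → ℝ) (G : SR (σ₁ ⊕ σ₂)),
      M.symm (rhoS (blockPhase s₁ s₂ (P, Q)).1 (blockPhase s₁ s₂ (P, Q)).2 G) = rhoS P Q (M.symm G) := by
    intro P Q G
    apply M.injective
    rw [hM, ContinuousLinearEquiv.apply_symm_apply, ContinuousLinearEquiv.apply_symm_apply]
  -- so `R = M⁻¹ T` commutes with every `ρ(P,Q)`
  have hR : ∀ (P Q : σ₁ ⊕ σ₂ → ℝ) (G : SR (σ₁ ⊕ σ₂)), R (rhoS P Q G) = rhoS P Q (R G) := by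
    intro P Q G
    rw [hRapp, hRapp, tensor_covariant A₁ A₂ hA₁ hA₂ T hT, hMs]
  have hS := eq_smul_of_commute_rhoS R hR F
  rw [hRapp] at hS
  have h2 := congrArg M hS
  rwa [ContinuousLinearEquiv.apply_symm_apply, map_smul] at h2

/-- **Two-factor Schur lemma (existential form)**: under the hypotheses of `eq_smul_of_tensor_covariant`,
`∃ c, T = c • M`; in particular `A₁ f ⊠ A₂ g = c • M (f ⊠ g)` for all `f, g`. [cite: Folland1989, Prop. (1.43)] -/
theorem exists_smul_of_tensor_covariant (M : (SR (σ₁ ⊕ σ₂)) ≃L[ℂ] SR (σ₁ ⊕ σ₂))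
    (hM : ∀ (P Q : σ₁ ⊕ σ₂ → ℝ) (F : SR (σ₁ ⊕ σ₂)),
      M (rhoS P Q F) = rhoS (blockPhase s₁ s₂ (P, Q)).1 (blockPhase s₁ s₂ (P, Q)).2 (M F))
    (A₁ : (SR σ₁) →L[ℂ] SR σ₁) (A₂ : (SR σ₂) →L[ℂ] SR σ₂)
    (hA₁ : ∀ (p q : σ₁ → ℝ) (f : SR σ₁), A₁ (rhoS p q f) = rhoS (s₁ (p, q)).1 (s₁ (p, q)).2 (A₁ f))
    (hA₂ : ∀ (p q : σ₂ → ℝ) (g : SR σ₂), A₂ (rhoS p q g) = rhoS (s₂ (p, q)).1 (s₂ (p, q)).2 (A₂ g))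
    (T : (SR (σ₁ ⊕ σ₂)) →L[ℂ] SR (σ₁ ⊕ σ₂))
    (hT : ∀ (f : SR σ₁) (g : SR σ₂), T (tensorPi f g) = tensorPi (A₁ f) (A₂ g)) :
    ∃ c : ℂ, (∀ F, T F = c • M F) ∧ ∀ (f : SR σ₁) (g : SR σ₂), tensorPi (A₁ f) (A₂ g) = c • M (tensorPi f g) :=
  ⟨_, fun F => eq_smul_of_tensor_covariant M hM A₁ A₂ hA₁ hA₂ T hT F, fun f g => by
    rw [← hT]; exact eq_smul_of_tensor_covariant M hM A₁ A₂ hA₁ hA₂ T hT _⟩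

/-- **Two-factor Schur lemma, statement of record at the archimedean place**: if moreover `A₁ ≠ 0` and `A₂ ≠ 0`,
then there is `c ≠ 0` with `M (f ⊠ g) = c • (A₁ f ⊠ A₂ g)` for all `f, g` — the restriction of the big
implementer to pure tensors is the tensor of the small ones up to ONE nonzero scalar. [cite: Folland1989, Prop. (1.43)] -/
theorem exists_ne_zero_smul_of_tensor_covariant (M : (SR (σ₁ ⊕ σ₂)) ≃L[ℂ] SR (σ₁ ⊕ σ₂))
    (hM : ∀ (P Q : σ₁ ⊕ σ₂ → ℝ) (F : SR (σ₁ ⊕ σ₂)),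
      M (rhoS P Q F) = rhoS (blockPhase s₁ s₂ (P, Q)).1 (blockPhase s₁ s₂ (P, Q)).2 (M F))
    (A₁ : (SR σ₁) →L[ℂ] SR σ₁) (A₂ : (SR σ₂) →L[ℂ] SR σ₂) (hA₁0 : A₁ ≠ 0) (hA₂0 : A₂ ≠ 0)
    (hA₁ : ∀ (p q : σ₁ → ℝ) (f : SR σ₁), A₁ (rhoS p q f) = rhoS (s₁ (p, q)).1 (s₁ (p, q)).2 (A₁ f))
    (hA₂ : ∀ (p q : σ₂ → ℝ) (g : SR σ₂), A₂ (rhoS p q g) = rhoS (s₂ (p, q)).1 (s₂ (p, q)).2 (A₂ g))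
    (T : (SR (σ₁ ⊕ σ₂)) →L[ℂ] SR (σ₁ ⊕ σ₂))
    (hT : ∀ (f : SR σ₁) (g : SR σ₂), T (tensorPi f g) = tensorPi (A₁ f) (A₂ g)) :
    ∃ c : ℂ, c ≠ 0 ∧ (∀ F, M F = c • T F) ∧
      ∀ (f : SR σ₁) (g : SR σ₂), M (tensorPi f g) = c • tensorPi (A₁ f) (A₂ g) := by
  obtain ⟨c, hc, hcfg⟩ := exists_smul_of_tensor_covariant M hM A₁ A₂ hA₁ hA₂ T hT
  -- `c ≠ 0`: pick `f₀, g₀` with `A₁ f₀ ≠ 0`, `A₂ g₀ ≠ 0`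
  obtain ⟨f₀, hf₀⟩ : ∃ f₀, A₁ f₀ ≠ 0 := by
    by_contra h; push Not at h; exact hA₁0 (ContinuousLinearMap.ext h)
  obtain ⟨g₀, hg₀⟩ : ∃ g₀, A₂ g₀ ≠ 0 := by
    by_contra h; push Not at h; exact hA₂0 (ContinuousLinearMap.ext h)
  have hc0 : c ≠ 0 := by
    intro h0
    have h1 := hcfg f₀ g₀
    rw [h0, zero_smul] at h1
    exact tensorPi_ne_zero hf₀ hg₀ h1
  refine ⟨c⁻¹, inv_ne_zero hc0, fun F => ?_, fun f g => ?_⟩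
  · rw [hc F, smul_smul, inv_mul_cancel₀ hc0, one_smul]
  · rw [← hT, hc, smul_smul, inv_mul_cancel₀ hc0, one_smul]

/-- The same for continuous linear AUTOMORPHISMS `A_j` (which are nonzero). [cite: Folland1989, Prop. (1.43)] -/
theorem exists_ne_zero_smul_of_tensor_covariant_equiv (M : (SR (σ₁ ⊕ σ₂)) ≃L[ℂ] SR (σ₁ ⊕ σ₂))
    (hM : ∀ (P Q : σ₁ ⊕ σ₂ → ℝ) (F : SR (σ₁ ⊕ σ₂)),
      M (rhoS P Q F) = rhoS (blockPhase s₁ s₂ (P, Q)).1 (blockPhase s₁ s₂ (P, Q)).2 (M F))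
    (A₁ : (SR σ₁) ≃L[ℂ] SR σ₁) (A₂ : (SR σ₂) ≃L[ℂ] SR σ₂)
    (hA₁ : ∀ (p q : σ₁ → ℝ) (f : SR σ₁), A₁ (rhoS p q f) = rhoS (s₁ (p, q)).1 (s₁ (p, q)).2 (A₁ f))
    (hA₂ : ∀ (p q : σ₂ → ℝ) (g : SR σ₂), A₂ (rhoS p q g) = rhoS (s₂ (p, q)).1 (s₂ (p, q)).2 (A₂ g))
    (T : (SR (σ₁ ⊕ σ₂)) →L[ℂ] SR (σ₁ ⊕ σ₂))
    (hT : ∀ (f : SR σ₁) (g : SR σ₂), T (tensorPi f g) = tensorPi (A₁ f) (A₂ g)) :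
    ∃ c : ℂ, c ≠ 0 ∧ (∀ F, M F = c • T F) ∧
      ∀ (f : SR σ₁) (g : SR σ₂), M (tensorPi f g) = c • tensorPi (A₁ f) (A₂ g) := by
  have h₁ : (A₁ : (SR σ₁) →L[ℂ] SR σ₁) ≠ 0 := fun h => by
    have h1 := congrArg (fun R : (SR σ₁) →L[ℂ] SR σ₁ => R (hermitePi 0)) h
    exact hermitePi_ne_zero 0 (A₁.injective (h1.trans (map_zero A₁).symm))
  have h₂ : (A₂ : (SR σ₂) →L[ℂ] SR σ₂) ≠ 0 := fun h => by
    have h1 := congrArg (fun R : (SR σ₂) →L[ℂ] SR σ₂ => R (hermitePi 0)) h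
    exact hermitePi_ne_zero 0 (A₂.injective (h1.trans (map_zero A₂).symm))
  exact exists_ne_zero_smul_of_tensor_covariant M hM A₁ A₂ h₁ h₂ hA₁ hA₂ T hT

end Schur

end Literature.Analysis.SegalBargmann

end
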